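import Summits.HubbardSuperconductivity.HubbardSuperconductivity.Theses.NodalWardXY
import Summits.HubbardSuperconductivity.HubbardSuperconductivity.Theses.WeakCouplingBCS
import Literature.MathematicalPhysics.QuantumLattice.DWaveOrderParameterProofs
import Literature.MathematicalPhysics.QuantumLattice.DWaveSourceFreeGainBound
import Literature.MathematicalPhysics.QuantumLattice.LiebFluxPhaseProofs
import Literature.MathematicalPhysics.QuantumLattice.FermionLiebRobinson

/-!
# Disproof of `NodalReduction` (stmt-HubbardSuperconductivity-1268) — standing adversary, gen 1 (cycle 1)

Crux (route `NodalWardXY`, rank 5, "the programme itself"):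

  `NodalReduction := VisonPairCost → PerturbedXYOrder → Window`,
  `Window := ∃ δ ∈ (0,1/2), ∃ U₀ > 0, ∀ U ∈ (0,U₀), ∃ μ, DensityMatched U δ μ ∧ HasDWaveOrder U μ`

(`DensityMatched`: the grand-canonical tracial ground-state density of `hubbardTorusWith 2 (L+1) 1 U μ` tends
to `1 - δ` along all sides; `HasDWaveOrder U μ := 0 < dWaveOrderParameter U μ`, the Koma–Tasaki `d_{x²-y²}`
order parameter, `L → ∞` first, then source `h ↓ 0`). Work file of refuter-cdisprove-…-1268-0; every claim
below is a CHECKED THEOREM (rc 0, no sorry, axioms ⊆ {propext, Classical.choice, Quot.sound}) unless marked DOC.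

## Findings (index)

§1 NORMAL FORMS — `crux_iff` (the crux is literally `V → P → Window`), `not_crux_iff`
   (`¬crux ↔ V ∧ P ∧ ¬Window`), `not_window_iff` (absence of order at arbitrarily weak coupling, every doping).
§2 WHY IT RESISTS — both hypotheses are CLOSED propositions: a disproof must PROVE the rank-2 crux
   `VisonPairCost` (`not_crux_imp_vison`) AND the rank-3 engine `PerturbedXYOrder` (`not_crux_imp_engine`,
   an unwritten complex-kernel extension of Balaban's RG) AND an absence-of-`d`-wave-order theorem at
   arbitrarily small `U > 0` for every `δ ∈ (0,1/2)` (`not_crux_imp_not_window`; no technique: the catalogued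
   absence results are `T > 0` — `PositiveTemperatureNoPairLRO`, `HohenbergMerminWagnerPairing` — or
   variational — `GeneralizedHartreeFockNoPairing`); conversely the kill criteria K1/K3 of the route PROVE the
   crux vacuously (`crux_of_not_vison`, `crux_of_not_engine`), and so does the window (`crux_of_window`).
   `crux_of_bcsConstruction`: the sibling crux `WeakCouplingBCS.WcbcsBcsConstruction` (stmt-2010, floor
   `exp(-C/U²)`) IMPLIES this crux — one disproof here kills both. `not_crux_of_not_summit`: given the other
   three route items, `¬HubbardSuperconductivity → ¬NodalReduction` (contrapositive of `closes`).
§3 LOAD-BEARING LATTICE — `CruxWithoutVison`/`CruxWithoutEngine`: dropping a closed hypothesis that is TRUE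
   changes nothing (`cruxWithoutVison_iff_of_vison`, `cruxWithoutEngine_iff_of_engine`), dropping a false one
   turns a vacuous truth into (the other engine →) `Window`; `crux_iff_window_of_engines`. NO `_false_without_`
   theorem exists for either hypothesis: every mutilation is implied by `Window`, an open statement expected TRUE.
§4 QUANTIFIER ANATOMY; FREE WEAKENINGS — `closes_weak`: the route's deciding theorem goes through with
   `CruxWeak := V → P → WindowWeak`, `WindowWeak := ∀ U₁ > 0, ∃ U ∈ (0,U₁), ∃ δ ∈ (0,1/2), ∃ μ, matched ∧ order`
   (order at ARBITRARILY SMALL `U`, doping allowed to depend on `U`), because `SsbToTorusLRO` is uniform in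
   `δ, μ` and the summit asks for one `(U,δ)`. PLANNER NOTE: the filed crux is stronger than its only consumer
   in two quantifiers (`∀ U < U₀` and `∃δ ∀U`); the `∃δ ∀U` density-matching subtlety (no sweeping first-order
   density jump at weak coupling; cf. Cruxes/WcbcsBcsConstruction/PICKED.md) is NOT needed by this route.
   `window → WindowIO → WindowWeak`, `not_windowWeak_iff`.
§5 THE WEAK-COUPLING CEILING (new analysis, all proved): `free_gain_le` (free sourced energy gain
   `E_L(0,μ,0) - E_L(0,μ,s) ≤ (C₀(1+log β)s² + 2log2/β)L²`, from the landed BdG pressure gain and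
   `e^{-βE₀} ≤ Re Z ≤ 4^{L²}e^{-βE₀}`); `free_density_le_sqrt` (free sourced pair density `≤ K√s`, `s ∈ (0,1]`,
   uniformly on compacts `[μ₁,μ₂] ⊂ (-4,0)`); `groundEnergy_add_le`/`groundEnergy_le_add` (`|E₀(A+X)-E₀(A)| ≤ ‖X‖`);
   `dWaveSourceTorus_eq_add_smul` (`H_h(U) = H_h(0) + U·D`), `norm_doubleOcc_le` (`‖D‖ ≤ L²`);
   `density_le_free` (**`dWaveSourceDensity L U μ h ≤ 2·dWaveSourceDensity L 0 μ (2h) + U/h`**, all `L, μ`,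
   `U ≥ 0`, `h > 0`); `orderParameter_le_weakCoupling` (**`m(U,μ) ≤ 2K√(2h) + U/h`**, hence `m = O(U^{1/3})`);
   `dWaveOrderParameter_free_eq_zero` / `not_hasDWaveOrder_free` (**the free torus has NO `d`-wave order**,
   `μ ∈ (-4,0)`); `orderParameter_small_of_weakCoupling` (`m(U,μ) ≤ ε` for all `U ∈ [0,U₀(ε))`, uniformly in
   `μ ∈ [μ₁,μ₂]`).
§5b REFUTED NATURAL STRENGTHENINGS — `not_windowFromZeroOn` (S0: allowing `U = 0` is false — the open endpoint
   `0 < U` is load-bearing); `not_windowUniformOrderOn` (S1: a `U`-uniform floor `m₀ > 0` on the order parameter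
   is false on every compact of the hole-doped band); `window_order_le` (on the window itself the order
   parameter at the matched `μ_U ∈ [μ₁,μ₂]` is eventually `≤ ε`). CONSEQUENCE FOR PROVERS: the window is a
   window of parametrically WEAK order — `m(U,μ_U) → 0` as `U → 0⁺` is forced; the sibling floor `exp(-C/U²)`
   is consistent with the ceiling; any mechanism whose output does not vanish with `U` is wrong.
§6 THE ENGINES (vacuity probes; DOC) — K1 (`VisonPairCost` false ⇒ crux vacuous) DOES NOT FIRE NUMERICALLY: exact BdG
   diagonalisation of the two-vison cost `dE(L,R) = E₀(H_R) - E₀(H_0) = -½[Σ|eig M_R| - Σ|eig M_0|]` (kit job j008007 on THIS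
   item, 4 cores, 511 diagonalisations, `L ∈ {8,12,16,20,24,32,40,48}`, all `R ≤ L/2` for `L ≤ 24` and 14 values of `R` beyond;
   sanity: spectrum symmetric, `M` real symmetric, translation invariance to 1e-16, pure holonomy flip `R = L = 8` gives 0.18):
   `max_R |dE|` per `L` — (μ,Δ₀) = (-1,1): 1.55 1.65 1.62 1.47 1.26 1.57 1.60 1.46; (-0.5,0.5): 0.96 1.09 1.07 1.02 0.99 1.04 1.04 0.93;
   (-2,1): 1.43 0.58 1.34 1.36 0.95 1.35 1.35 1.15 (dips at 6∣L: nodes p = π/3 on the momentum grid, clean zero modes);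
   (-0.3,0.2): 0.13 0.40 0.54 0.56 0.52 0.30 0.27 0.28; (-1,0.3): 0.82 0.47 0.72 0.72 0.48 0.72 0.63 0.59 — least-squares slopes
   against `log L`: -0.055, -0.019, +0.061, +0.003, -0.052 (NO growth; bounded by 1.66 throughout); the `R`-profiles at `L = 48`
   rise from `R = 1` and PLATEAU by `R ≈ 4–6` (e.g. (-1,1): 1.05, 1.17, 1.33, 1.39, 1.40, 1.45, 1.46, 1.45, 1.45, …, 1.38 at
   `R = 24`), i.e. `dE → 2E_core + o(1)` with `E_core ≈ 0.7Δ₀`; the SIGN is POSITIVE at every admissible point (visons COST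
   energy — the favourable sign for kill criterion K2: vison-dressed vortex loops are suppressed, not favoured); vison mid-gap
   levels `min|eig M_{L/2}| ≈ 0.02–0.25`, never exact zero modes. CONTROLS (excluded by hypothesis) misbehave as predicted:
   `μ = 0` grows `≈ 0.54·log L` (0.45 → 1.44; nodes `(±π/2,±π/2)` sit ON the grid for `4∣L`, clean exact zero modes at every
   listed `L`), `Δ₀ = 0` is erratic in sign with an `R`-linear profile (Friedel/metal). READING: `VisonPairCost` is numerically TRUE
   on the tested window with `C(μ,Δ₀) ≲ 1.7`, so `NodalReduction` is NOT vacuous through its first hypothesis (finitely many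
   instances prove nothing in Lean — shape `∀μ∀Δ₀∃C∀L∀R` — but there is no suspect-false lead either; numbers + sha256 manifest
   attached to items 1268 and 1266). K3 (`PerturbedXYOrder` false ⇒ crux vacuous): no
   cheap zero of `Z_K` — in the spin-wave (Gaussian) approximation at large `J`,
   `Z_K/Z_0 = det(1 - 2 C A_K)^{-1/2}` with `‖C^{1/2}A_KC^{1/2}‖ ≲ ε·S₃/J` (`S₃ = Σ_{x∈ℤ³}(1+|x|₁)⁻⁴ ≈ 2.55`): NO
   zeros and poles only at `|K| ∼ J`, far outside the `ε`-disc once `ε ≪ J₀`; per-block factors cannot vanish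
   either (`|W_block| ≤ 9εS₃ < π/2` for `ε < 0.068`); zeros of the entire function `w ↦ E_J[e^{wQ}]` sit at
   `|w| ≳ J`, so Hadamard's "must have zeros" does not bite in the disc. Formal traps checked: `torusGraph 3 L`
   is connected for `L ≥ 1` (honest `dist`, kernel class genuinely summable, `|W| ≤ 9εS₃L³`); the integrand is
   continuous and bounded on the compact cube, so `Z` is an honest Bochner integral (no `Z = 0` by
   non-integrability); `L = 2` bond doubling only rescales `J`. The rank-3 engine resists cheap attack; its
   truth is a Balaban-class constructive theorem (open), NOT decidable by small models (the refuter must beat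
   every `(J₀, ε)`, i.e. `ε/J₀ → 0`).
§7 OTHER STRENGTHENINGS / DEGENERATE REGIMES (DOC) — "∀ δ ∈ (0,1/2)" (all dopings): physically false for
   `δ ≳ 0.4` (`d_xy` wins, Raghu–Kivelson–Scalapino 2010 Fig. 2) but not Lean-refutable (needs absence of
   `B1g` order in an interacting ground state); "∃ μ ∀ U" (one chemical potential for all couplings): false as
   soon as the interacting density moves with `U` at fixed `μ`, equally unprovable now; `δ = 0` endpoint
   excluded by the open interval (half filling: AF competes; odd sides `L+1` are not bipartite but limits do not
   care); the `liminf`s in `dWaveOrderParameter` are never junk (`|density| ≤ 4√2`, tree). The a priori sign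
   `0 ≤ m(U,μ)` (tree `dWaveOrderParameter_nonneg`) means no sign/symmetry argument can refute positivity.

VERDICT (cycle 1): no kill. `¬NodalReduction` = (both engines) ∧ (no weak-coupling `d`-wave window) is
open-problem-complete on its negative side exactly as the crux is on its positive side; the checked content a
disprover CAN extract is the weak-coupling CEILING of §5 (new: the order parameter of the window must vanish
as `U → 0⁺`; the free torus is orderless) and the free quantifier weakening of §4.
-/

noncomputable section

set_option linter.dupNamespace false

namespace Summit.HubbardSuperconductivity.HubbardSuperconductivity.Cruxes.NodalReduction.Disproof

open Filter Set Literature.MathematicalPhysics.QuantumLattice Literature.Probability.LatticeModels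
open Summit.HubbardSuperconductivity.HubbardSuperconductivity.Theses.NodalWardXY
open scoped Topology

/-! ## §1 Normal forms -/

/-- Density matching at `(U, δ, μ)`: the grand-canonical tracial ground-state density of
`hubbardTorusWith 2 (L+1) 1 U μ` tends to `1 - δ` along ALL sides (the crux's first conjunct, verbatim). -/
def DensityMatched (U δ μ : ℝ) : Prop :=
  Tendsto (fun L : ℕ => ((hubbardTorusWith 2 (L + 1) 1 U μ).groundStateFunctional totalNumber).re /
    ((L + 1 : ℕ) : ℝ) ^ 2) atTop (𝓝 (1 - δ))

/-- THE CONTENT of the crux: the weak-coupling `d`-wave window — some doping `δ ∈ (0,1/2)` such that for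
ALL sufficiently small `U > 0` some density-matched `μ` carries Koma–Tasaki `d_{x²-y²}` order. -/
def Window : Prop :=
  ∃ δ ∈ Set.Ioo (0:ℝ) (1/2), ∃ U₀ : ℝ, 0 < U₀ ∧ ∀ U ∈ Set.Ioo (0:ℝ) U₀, ∃ μ : ℝ,
    DensityMatched U δ μ ∧ HasDWaveOrder U μ

/-- The crux is LITERALLY `VisonPairCost → PerturbedXYOrder → Window`. -/
theorem crux_iff : NodalReduction ↔ (VisonPairCost → PerturbedXYOrder → Window) := Iff.rfl

/-- Negation normal form: a disproof is EXACTLY (a proof of the vison engine) ∧ (a proof of the XY engine)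
∧ (absence of the weak-coupling window). Both hypotheses are CLOSED propositions, so they cannot be "used"
in any parameter-dependent way: they are lemmas awaiting proof, and refuting the crux requires proving both. -/
theorem not_crux_iff : ¬ NodalReduction ↔ (VisonPairCost ∧ PerturbedXYOrder ∧ ¬ Window) := by
  rw [crux_iff]; tauto

/-- What "absence of the window" says: for EVERY doping `δ ∈ (0,1/2)` and every `U₀ > 0` there is a
coupling `U ∈ (0,U₀)` at which NO density-matched `μ` has `d`-wave order — an absence-of-order theorem at
arbitrarily weak repulsion, for every doping. -/
theorem not_window_iff :
    ¬ Window ↔ ∀ δ ∈ Set.Ioo (0:ℝ) (1/2), ∀ U₀ : ℝ, 0 < U₀ → ∃ U ∈ Set.Ioo (0:ℝ) U₀, ∀ μ : ℝ,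
      DensityMatched U δ μ → ¬ HasDWaveOrder U μ := by
  unfold Window
  push Not
  rfl

/-! ## §2 Why it resists (logic) -/

/-- The window alone proves the crux (hypotheses are decoration for a prover who has the window). -/
theorem crux_of_window (h : Window) : NodalReduction := fun _ _ => h

/-- Kill criterion K1 (vison cost unbounded) would PROVE the crux, vacuously. -/
theorem crux_of_not_vison (h : ¬ VisonPairCost) : NodalReduction := fun hv => absurd hv h

/-- Kill criterion K3 (an admissible complex kernel with `Z_K = 0` or no plateau) would PROVE the crux,
vacuously. -/
theorem crux_of_not_engine (h : ¬ PerturbedXYOrder) : NodalReduction := fun _ hp => absurd hp h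

/-- Any disproof contains a proof of the rank-2 crux `VisonPairCost`. -/
theorem not_crux_imp_vison (h : ¬ NodalReduction) : VisonPairCost := (not_crux_iff.1 h).1

/-- Any disproof contains a proof of the rank-3 engine `PerturbedXYOrder` (an unwritten extension of
Balaban's low-temperature RG to complex `(1+dist)⁻⁴` two-current kernels). -/
theorem not_crux_imp_engine (h : ¬ NodalReduction) : PerturbedXYOrder := (not_crux_iff.1 h).2.1

/-- Any disproof contains an absence-of-`d`-wave-order theorem at arbitrarily weak coupling (§1). -/
theorem not_crux_imp_not_window (h : ¬ NodalReduction) : ¬ Window := (not_crux_iff.1 h).2.2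

/-- The sibling route's crux `Theses.WeakCouplingBCS.WcbcsBcsConstruction` (stmt-0159/2010: density-matched `μ`
with the QUANTITATIVE floor `exp(-C/U²) ≤ m(U,μ)`) implies the window. -/
theorem window_of_bcsConstruction (h : Theses.WeakCouplingBCS.WcbcsBcsConstruction) : Window := by
  obtain ⟨δ, hδ, U₀, hU₀, C, _hC, hw⟩ := h
  refine ⟨δ, hδ, U₀, hU₀, fun U hU => ?_⟩
  obtain ⟨μ, hdens, hord⟩ := hw U hU
  exact ⟨μ, hdens, (hasDWaveOrder_iff U μ).2 (lt_of_lt_of_le (Real.exp_pos _) hord)⟩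

/-- Hence `WcbcsBcsConstruction → NodalReduction`: this crux is WEAKER than the sibling route's
construction crux; one proof of stmt-2010 closes both, one disproof of this crux kills both. -/
theorem crux_of_bcsConstruction (h : Theses.WeakCouplingBCS.WcbcsBcsConstruction) : NodalReduction :=
  crux_of_window (window_of_bcsConstruction h)

/-- Contrapositive bookkeeping. -/
theorem not_bcsConstruction_of_not_crux (h : ¬ NodalReduction) : ¬ Theses.WeakCouplingBCS.WcbcsBcsConstruction :=
  fun h' => h (crux_of_bcsConstruction h')

/-- Given the other three route items, a disproof of the SUMMIT is a disproof of this crux (contrapositive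
of the deciding theorem `closes`): with the engines and the transfer in hand, `¬ NodalReduction` is squeezed
between `¬ HubbardSuperconductivity` (sufficient) and `¬ Window` (necessary). -/
theorem not_crux_of_not_summit (hV : VisonPairCost) (hP : PerturbedXYOrder) (hS : SsbToTorusLRO)
    (h : ¬ _root_.HubbardSuperconductivity) : ¬ NodalReduction :=
  fun hN => h (closes hV hP hS hN)

/-! ## §3 Load-bearing lattice (the hypotheses are closed propositions) -/

/-- The crux with the vison hypothesis dropped. -/
def CruxWithoutVison : Prop := PerturbedXYOrder → Window

/-- The crux with the XY-engine hypothesis dropped. -/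
def CruxWithoutEngine : Prop := VisonPairCost → Window

theorem cruxWithoutVison_of_window (h : Window) : CruxWithoutVison := fun _ => h
theorem cruxWithoutEngine_of_window (h : Window) : CruxWithoutEngine := fun _ => h
theorem crux_of_cruxWithoutVison (h : CruxWithoutVison) : NodalReduction := fun _ hp => h hp
theorem crux_of_cruxWithoutEngine (h : CruxWithoutEngine) : NodalReduction := fun hv _ => h hv

/-- Dropping a TRUE closed hypothesis changes nothing … -/
theorem cruxWithoutVison_iff_of_vison (hv : VisonPairCost) : CruxWithoutVison ↔ NodalReduction :=
  ⟨crux_of_cruxWithoutVison, fun h hp => h hv hp⟩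

/-- … and symmetrically for the engine. -/
theorem cruxWithoutEngine_iff_of_engine (hp : PerturbedXYOrder) : CruxWithoutEngine ↔ NodalReduction :=
  ⟨crux_of_cruxWithoutEngine, fun h hv => h hv hp⟩

/-- If BOTH engines hold, the crux IS the window. -/
theorem crux_iff_window_of_engines (hv : VisonPairCost) (hp : PerturbedXYOrder) :
    NodalReduction ↔ Window :=
  ⟨fun h => h hv hp, crux_of_window⟩

/-! ## §4 Quantifier anatomy of the window; FREE weakenings the assembly tolerates -/

/-- Window, "infinitely often" form: order at ARBITRARILY SMALL `U` (not at all small `U`), `δ` still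
uniform. -/
def WindowIO : Prop :=
  ∃ δ ∈ Set.Ioo (0:ℝ) (1/2), ∀ U₁ : ℝ, 0 < U₁ → ∃ U ∈ Set.Ioo (0:ℝ) U₁, ∃ μ : ℝ,
    DensityMatched U δ μ ∧ HasDWaveOrder U μ

/-- Weakest form: for every `U₁ > 0` SOME `U ∈ (0,U₁)`, SOME doping `δ ∈ (0,1/2)` (allowed to depend on
`U`) and some density-matched `μ` with order. -/
def WindowWeak : Prop :=
  ∀ U₁ : ℝ, 0 < U₁ → ∃ U ∈ Set.Ioo (0:ℝ) U₁, ∃ δ ∈ Set.Ioo (0:ℝ) (1/2), ∃ μ : ℝ,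
    DensityMatched U δ μ ∧ HasDWaveOrder U μ

theorem windowIO_of_window (h : Window) : WindowIO := by
  obtain ⟨δ, hδ, U₀, hU₀, hw⟩ := h
  refine ⟨δ, hδ, fun U₁ hU₁ => ?_⟩
  have hm : 0 < min U₀ U₁ := lt_min hU₀ hU₁
  obtain ⟨μ, hμ⟩ := hw (min U₀ U₁ / 2)
    ⟨half_pos hm, lt_of_lt_of_le (half_lt_self hm) (min_le_left _ _)⟩
  exact ⟨min U₀ U₁ / 2, ⟨half_pos hm, lt_of_lt_of_le (half_lt_self hm) (min_le_right _ _)⟩, μ, hμ⟩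

theorem windowWeak_of_windowIO (h : WindowIO) : WindowWeak := by
  obtain ⟨δ, hδ, hw⟩ := h
  intro U₁ hU₁
  obtain ⟨U, hU, μ, hμ⟩ := hw U₁ hU₁
  exact ⟨U, hU, δ, hδ, μ, hμ⟩

/-- The crux in its weakest route-closing form. -/
def CruxWeak : Prop := VisonPairCost → PerturbedXYOrder → WindowWeak

theorem cruxWeak_of_crux (h : NodalReduction) : CruxWeak :=
  fun hv hp => windowWeak_of_windowIO (windowIO_of_window (h hv hp))

/-- **The route closes with the WEAK form** (same eight lines of logic as `closes`): neither "order for ALL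
small `U`" nor "`δ` uniform in `U`" is consumed by the assembly, because `SsbToTorusLRO` is uniform in
`δ ∈ (0,1/2)` and `μ`, and the summit only asks for ONE `(U, δ)`. Planner information: `NodalReduction` as
filed is stronger than its only consumer needs in two quantifiers (`∀ U < U₀` → `∃ U < U₁ ∀ U₁`;
`∃ δ ∀ U` → `∀ U₁ ∃ U ∃ δ`) — the `∃δ ∀U` density-matching subtlety (no sweeping first-order density jump
at weak coupling, cf. Cruxes/WcbcsBcsConstruction/PICKED.md) is NOT needed here. -/
theorem closes_weak (hV : VisonPairCost) (hP : PerturbedXYOrder) (hS : SsbToTorusLRO)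
    (hN : CruxWeak) : _root_.HubbardSuperconductivity := by
  obtain ⟨U₁, hU₁, htr⟩ := hS
  obtain ⟨U, hU, δ, hδ, μ, hdens, hord⟩ := hN hV hP U₁ hU₁
  exact ⟨U, hU.1, δ, hδ, htr U hU δ hδ μ hdens hord⟩

/-- Conversely a disproof of even the weak form needs: for some `U₁ > 0`, NO `U < U₁`, NO doping in
`(0,1/2)` and NO density-matched `μ` has order — absence of weak-coupling `d`-wave order outright. -/
theorem not_windowWeak_iff :
    ¬ WindowWeak ↔ ∃ U₁ : ℝ, 0 < U₁ ∧ ∀ U ∈ Set.Ioo (0:ℝ) U₁, ∀ δ ∈ Set.Ioo (0:ℝ) (1/2), ∀ μ : ℝ,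
      DensityMatched U δ μ → ¬ HasDWaveOrder U μ := by
  unfold WindowWeak
  push Not
  rfl


/-! ## §5 The weak-coupling ceiling: free no-order, `m(U,μ) → 0` as `U → 0⁺`, refuted strengthenings

Everything in this section is about the tree's objects `dWaveSourceTorus`, `dWaveSourceDensity`,
`dWaveOrderParameter`, `HasDWaveOrder` at `U ≥ 0`; it uses the landed BdG pressure-gain bound of the FREE
sourced torus (`dWaveSource_free_sourcedGain_le`, `DWaveSourceFreeGainBound.lean`), the partition-function /
ground-energy sandwich (`exp_neg_mul_groundEnergy_le_partitionFn`, `partitionFn_le_card_mul_exp`,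
`LiebFluxPhaseProofs.lean`) and the Koma–Tasaki energy sandwich (`DWaveSourceProofs.lean`,
`DWaveOrderParameterProofs.lean`). -/

section WeakCouplingCeiling

open Matrix
open scoped Matrix.Norms.L2Operator ComplexOrder

/-- Fock-space dimension bookkeeping: `log |Finset (Orb (FermionTorus 2 L))| = 2L² log 2`. -/
theorem log_card_fock (L : ℕ) :
    Real.log (Fintype.card (Finset (Orb (FermionTorus 2 L))) : ℝ) = 2 * (L : ℝ) ^ 2 * Real.log 2 := by
  rw [Fintype.card_finset, card_orb_fermionTorus_two]
  push_cast
  rw [Real.log_pow]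
  push_cast
  ring

/-- **Free sourced energy gain** (from the BdG pressure gain and `e^{-βE₀} ≤ Re Z ≤ D e^{-βE₀}`):
for `[μ₁,μ₂] ⊂ (-4,0)` there is `C₀ > 0` with, for `β ≥ 1`, `μ ∈ [μ₁,μ₂]`, eventually in `L`, all `s`:
`E_L(0,μ,0) - E_L(0,μ,s) ≤ (C₀(1+log β)s² + 2 log 2/β) L²`. -/
theorem free_gain_le (μ₁ μ₂ : ℝ) (h4 : -4 < μ₁) (h12 : μ₁ ≤ μ₂) (h0 : μ₂ < 0) :
    ∃ C₀ : ℝ, 0 < C₀ ∧ ∀ β : ℝ, 1 ≤ β → ∀ μ ∈ Set.Icc μ₁ μ₂, ∃ L₀ : ℕ, ∀ (L : ℕ) [NeZero L], L₀ ≤ L →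
      ∀ s : ℝ, (dWaveSourceTorus L 0 μ 0).groundEnergy - (dWaveSourceTorus L 0 μ s).groundEnergy ≤
        (C₀ * (1 + Real.log β) * s ^ 2 + 2 * Real.log 2 / β) * (L : ℝ) ^ 2 := by
  obtain ⟨C₀, hC₀, hgain⟩ := dWaveSource_free_sourcedGain_le μ₁ μ₂ h4 h12 h0
  refine ⟨C₀, hC₀, fun β hβ μ hμ => ?_⟩
  obtain ⟨L₀, hL₀⟩ := hgain β hβ μ hμ
  refine ⟨L₀, fun L _ hL s => ?_⟩
  have hβ0 : 0 < β := by linarith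
  have hLpos : (0 : ℝ) < (L : ℝ) ^ 2 := cast_sq_pos_of_neZero L
  have hβL : 0 < β * (L : ℝ) ^ 2 := by positivity
  have key := hL₀ L hL s
  set Hs := dWaveSourceTorus L 0 μ s with hHs
  set H0 := dWaveSourceTorus L 0 μ 0 with hH0
  have hHs_herm : Hs.IsHermitian := dWaveSourceTorus_isHermitian L (isHermitian_hubbardTorusWith L 1 0 μ) s
  have hH0_herm : H0.IsHermitian := dWaveSourceTorus_isHermitian L (isHermitian_hubbardTorusWith L 1 0 μ) 0
  -- e^{-βE₀(s)} ≤ Re Z(s)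
  have h1 := exp_neg_mul_groundEnergy_le_partitionFn hHs_herm β
  -- Re Z(0) ≤ D e^{-βE₀(0)}
  have h2 := partitionFn_le_card_mul_exp hH0_herm hβ0.le
  have h2' := exp_neg_mul_groundEnergy_le_partitionFn hH0_herm β
  have hZs_pos : 0 < (partitionFn β Hs).re := lt_of_lt_of_le (Real.exp_pos _) h1
  have hZ0_pos : 0 < (partitionFn β H0).re := lt_of_lt_of_le (Real.exp_pos _) h2'
  have hD : (0 : ℝ) < Fintype.card (Finset (Orb (FermionTorus 2 L))) := by exact_mod_cast Fintype.card_pos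
  have hlog1 : -(β * Hs.groundEnergy) ≤ Real.log (partitionFn β Hs).re := by
    have := Real.log_le_log (Real.exp_pos _) h1
    rwa [Real.log_exp] at this
  have hlog2 : Real.log (partitionFn β H0).re ≤ 2 * (L : ℝ) ^ 2 * Real.log 2 + -(β * H0.groundEnergy) := by
    have := Real.log_le_log hZ0_pos h2
    rwa [Real.log_mul hD.ne' (Real.exp_pos _).ne', Real.log_exp, log_card_fock] at this
  -- the pressure gain, multiplied out
  have key' : Real.log (partitionFn β Hs).re - Real.log (partitionFn β H0).re ≤
      C₀ * (1 + Real.log β) * s ^ 2 * (β * (L : ℝ) ^ 2) := by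
    rw [← sub_div, div_le_iff₀ hβL] at key
    exact key
  have main : β * (H0.groundEnergy - Hs.groundEnergy) ≤
      C₀ * (1 + Real.log β) * s ^ 2 * (β * (L : ℝ) ^ 2) + 2 * (L : ℝ) ^ 2 * Real.log 2 := by
    linarith
  have : H0.groundEnergy - Hs.groundEnergy ≤
      C₀ * (1 + Real.log β) * s ^ 2 * (L : ℝ) ^ 2 + 2 * (L : ℝ) ^ 2 * Real.log 2 / β := by
    rw [← sub_nonneg] at main ⊢
    have : (C₀ * (1 + Real.log β) * s ^ 2 * (L : ℝ) ^ 2 + 2 * (L : ℝ) ^ 2 * Real.log 2 / β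
        - (H0.groundEnergy - Hs.groundEnergy)) = (C₀ * (1 + Real.log β) * s ^ 2 * (β * (L : ℝ) ^ 2)
        + 2 * (L : ℝ) ^ 2 * Real.log 2 - β * (H0.groundEnergy - Hs.groundEnergy)) / β := by
      field_simp
    rw [this]
    positivity
  calc H0.groundEnergy - Hs.groundEnergy
      ≤ C₀ * (1 + Real.log β) * s ^ 2 * (L : ℝ) ^ 2 + 2 * (L : ℝ) ^ 2 * Real.log 2 / β := this
    _ = (C₀ * (1 + Real.log β) * s ^ 2 + 2 * Real.log 2 / β) * (L : ℝ) ^ 2 := by ring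

/-- Elementary: for `0 < s ≤ 1`, `-(s * log s) ≤ 2 √s` (from `log y ≤ y - 1` at `y = 1/√s`). -/
theorem neg_mul_log_le_two_sqrt {s : ℝ} (hs : 0 < s) : -(s * Real.log s) ≤ 2 * Real.sqrt s := by
  have hsq : Real.sqrt s * Real.sqrt s = s := Real.mul_self_sqrt hs.le
  have hr : 0 < Real.sqrt s := Real.sqrt_pos.2 hs
  have hlog : Real.log s = 2 * Real.log (Real.sqrt s) := by
    conv_lhs => rw [← hsq]
    rw [Real.log_mul hr.ne' hr.ne']; ring
  have h1 : Real.log (Real.sqrt s)⁻¹ ≤ (Real.sqrt s)⁻¹ - 1 := Real.log_le_sub_one_of_pos (inv_pos.2 hr)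
  rw [Real.log_inv] at h1
  -- -log √s ≤ 1/√s - 1 ≤ 1/√s ; multiply by 2s: -s log s = -2 s log √s ≤ 2 s/√s = 2√s
  have h2 : -(s * Real.log s) = 2 * s * (-Real.log (Real.sqrt s)) := by rw [hlog]; ring
  rw [h2]
  have h3 : -Real.log (Real.sqrt s) ≤ (Real.sqrt s)⁻¹ := by linarith
  calc 2 * s * (-Real.log (Real.sqrt s)) ≤ 2 * s * (Real.sqrt s)⁻¹ :=
        mul_le_mul_of_nonneg_left h3 (by positivity)
    _ = 2 * Real.sqrt s := by
        field_simp
        nlinarith [hsq]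

/-- **The free sourced `d`-wave pair density is `O(√s)`** (crude but uniform form of the Cooper-log law
`∼ s log(1/s)`): for `[μ₁,μ₂] ⊂ (-4,0)` there is `K > 0` such that for all `s ∈ (0,1]`, `μ ∈ [μ₁,μ₂]`,
eventually in `L`: `dWaveSourceDensity L 0 μ s ≤ K √s`. -/
theorem free_density_le_sqrt (μ₁ μ₂ : ℝ) (h4 : -4 < μ₁) (h12 : μ₁ ≤ μ₂) (h0 : μ₂ < 0) :
    ∃ K : ℝ, 0 < K ∧ ∀ s ∈ Set.Ioc (0:ℝ) 1, ∀ μ ∈ Set.Icc μ₁ μ₂, ∃ L₀ : ℕ, ∀ (L : ℕ) [NeZero L], L₀ ≤ L →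
      dWaveSourceDensity L 0 μ s ≤ K * Real.sqrt s := by
  obtain ⟨C₀, hC₀, hgain⟩ := free_gain_le μ₁ μ₂ h4 h12 h0
  refine ⟨10 * C₀ + 1, by positivity, fun s hs μ hμ => ?_⟩
  have hs0 : 0 < s := hs.1
  have hs1 : s ≤ 1 := hs.2
  set β : ℝ := (s ^ 2)⁻¹ with hβdef
  have hs2 : 0 < s ^ 2 := by positivity
  have hβ1 : 1 ≤ β := by
    rw [hβdef, one_le_inv₀ hs2]
    nlinarith
  obtain ⟨L₀, hL₀⟩ := hgain β hβ1 μ hμ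
  refine ⟨L₀, fun L _ hL => ?_⟩
  have hLpos : (0 : ℝ) < (L : ℝ) ^ 2 := cast_sq_pos_of_neZero L
  -- density ≤ (E(s) - E(2s)) / (2 s L²) ≤ (E(0) - E(2s)) / (2 s L²)
  have hd := dWaveSourceDensity_le_energyDrop_div (L := L) 0 μ hs0
  have hE0 := groundEnergy_dWaveSourceTorus_le (L := L) 0 μ s
  have hg := hL₀ L hL (2 * s)
  have hlogβ : Real.log β = -(2 * Real.log s) := by
    rw [hβdef, Real.log_inv, Real.log_pow]; push_cast; ring
  have hslog : -(s * Real.log s) ≤ 2 * Real.sqrt s := neg_mul_log_le_two_sqrt hs0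
  have hsqrt1 : s ≤ Real.sqrt s := by
    calc s = Real.sqrt (s ^ 2) := (Real.sqrt_sq hs0.le).symm
      _ ≤ Real.sqrt s := Real.sqrt_le_sqrt (by nlinarith)
  have hsqrt0 : 0 ≤ Real.sqrt s := Real.sqrt_nonneg s
  have hlog2 : Real.log 2 ≤ 1 := by
    have := Real.log_le_sub_one_of_pos (show (0:ℝ) < 2 by norm_num); linarith
  have hpos : (0 : ℝ) < 2 * s * (L : ℝ) ^ 2 := by positivity
  -- combine
  have step1 : dWaveSourceDensity L 0 μ s * (2 * s * (L : ℝ) ^ 2) ≤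
      (C₀ * (1 + Real.log β) * (2 * s) ^ 2 + 2 * Real.log 2 / β) * (L : ℝ) ^ 2 := by
    rw [le_div_iff₀ hpos] at hd
    linarith
  have hβinv : 2 * Real.log 2 / β = 2 * Real.log 2 * s ^ 2 := by
    rw [hβdef, div_inv_eq_mul]
  rw [hβinv, hlogβ] at step1
  -- step1 : dens * (2 s L²) ≤ (C₀ (1 - 2 log s) 4 s² + 2 log2 s²) L²
  -- target: dens ≤ (10 C₀ + 1) √s
  have target : (C₀ * (1 + -(2 * Real.log s)) * (2 * s) ^ 2 + 2 * Real.log 2 * s ^ 2) * (L : ℝ) ^ 2 ≤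
      (10 * C₀ + 1) * Real.sqrt s * (2 * s * (L : ℝ) ^ 2) := by
    -- divide the claim by 2 s L² > 0: 2C₀ s (1 - 2 log s) + s log 2 ≤ (10C₀+1) √s
    have inner : C₀ * (1 + -(2 * Real.log s)) * (2 * s) + Real.log 2 * s ≤ (10 * C₀ + 1) * Real.sqrt s := by
      have e1 : C₀ * (1 + -(2 * Real.log s)) * (2 * s) = 2 * C₀ * s + 4 * C₀ * (-(s * Real.log s)) := by ring
      rw [e1]
      have a1 : 2 * C₀ * s ≤ 2 * C₀ * Real.sqrt s := mul_le_mul_of_nonneg_left hsqrt1 (by positivity)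
      have a2 : 4 * C₀ * (-(s * Real.log s)) ≤ 4 * C₀ * (2 * Real.sqrt s) :=
        mul_le_mul_of_nonneg_left hslog (by positivity)
      have a3 : Real.log 2 * s ≤ 1 * Real.sqrt s :=
        mul_le_mul hlog2 hsqrt1 hs0.le zero_le_one
      linarith
    have := mul_le_mul_of_nonneg_right inner hpos.le
    have e2 : (C₀ * (1 + -(2 * Real.log s)) * (2 * s) ^ 2 + 2 * Real.log 2 * s ^ 2) * (L : ℝ) ^ 2 =
        (C₀ * (1 + -(2 * Real.log s)) * (2 * s) + Real.log 2 * s) * (2 * s * (L : ℝ) ^ 2) := by ring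
    rw [e2]
    linarith
  exact le_of_mul_le_mul_right (step1.trans target) hpos

/-! ### Operator-norm stability of the ground energy; the interaction as a bounded perturbation -/

section Perturb

variable {n : Type*} [Fintype n] [DecidableEq n] [Nonempty n]

/-- `E₀(A + X) ≤ E₀(A) + ‖X‖` for Hermitian `A, X` (the ground state of `A` as trial state). [folklore] -/
theorem groundEnergy_add_le {A X : Matrix n n ℂ} (hA : A.IsHermitian) (hX : X.IsHermitian) :
    (A + X).groundEnergy ≤ A.groundEnergy + ‖X‖ := by
  have h := groundEnergy_le_groundStateFunctional_re hA (hA.add hX)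
  rw [map_add, Complex.add_re, groundStateFunctional_hamiltonian hA, Complex.ofReal_re] at h
  have h2 := (le_abs_self _).trans (abs_re_groundStateFunctional_le_norm hA X)
  linarith

/-- `E₀(A) ≤ E₀(A + X) + ‖X‖` for Hermitian `A, X`. [folklore] -/
theorem groundEnergy_le_add {A X : Matrix n n ℂ} (hA : A.IsHermitian) (hX : X.IsHermitian) :
    A.groundEnergy ≤ (A + X).groundEnergy + ‖X‖ := by
  have h := groundEnergy_add_le (hA.add hX) hX.neg
  rwa [add_neg_cancel_right, norm_neg] at h

end Perturb

/-- The on-site repulsion (double occupancy) operator `D = Σ_x n_{x↑} n_{x↓}` on the torus of side `L`. -/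
def doubleOcc (L : ℕ) : Matrix (Finset (Orb (FermionTorus 2 L))) (Finset (Orb (FermionTorus 2 L))) ℂ :=
  ∑ x : FermionTorus 2 L, numberOp x 0 * numberOp x 1

/-- `H_{L,h}(U) = H_{L,h}(0) + U·D`: the coupling enters the sourced Hamiltonian linearly through `D`. -/
theorem dWaveSourceTorus_eq_add_smul (L : ℕ) [NeZero L] (U μ s : ℝ) :
    dWaveSourceTorus L U μ s = dWaveSourceTorus L 0 μ s + (U : ℂ) • doubleOcc L := by
  simp only [dWaveSourceTorus, hubbardTorusWith, hamiltonianWith, hamiltonian, doubleOcc]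
  push_cast
  simp only [zero_smul, add_zero]
  abel

/-- `‖D‖ ≤ L²` (each `n_{x↑}n_{x↓}` has norm `≤ 1`). -/
theorem norm_doubleOcc_le (L : ℕ) : ‖doubleOcc L‖ ≤ (L : ℝ) ^ 2 := by
  unfold doubleOcc
  calc ‖∑ x : FermionTorus 2 L, numberOp x 0 * numberOp x 1‖
      ≤ ∑ x : FermionTorus 2 L, ‖(numberOp x 0 * numberOp x 1 :
          Matrix (Finset (Orb (FermionTorus 2 L))) (Finset (Orb (FermionTorus 2 L))) ℂ)‖ :=
        norm_sum_le _ _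
    _ ≤ ∑ _x : FermionTorus 2 L, (1 : ℝ) := Finset.sum_le_sum fun x _ =>
        (norm_mul_le _ _).trans
          (mul_le_one₀ (norm_numberOp_le_one x 0) (norm_nonneg _) (norm_numberOp_le_one x 1))
    _ = (L : ℝ) ^ 2 := by
        simp [FermionTorus, Fintype.card_lex]

/-- **Weak-coupling comparison of sourced pair densities** (finite `L`, every `μ`, `U ≥ 0`, `h > 0`):
`dWaveSourceDensity L U μ h ≤ 2 · dWaveSourceDensity L 0 μ (2h) + U/h` — the interacting response at
source `h` is controlled by the FREE response at source `2h` plus `U/h` (energy sandwich + `|ΔE₀| ≤ U‖D‖`). -/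
theorem density_le_free {L : ℕ} [NeZero L] {U : ℝ} (hU : 0 ≤ U) (μ : ℝ) {h : ℝ} (hh : 0 < h) :
    dWaveSourceDensity L U μ h ≤ 2 * dWaveSourceDensity L 0 μ (2 * h) + U / h := by
  have hK0 : ∀ s, (dWaveSourceTorus L 0 μ s).IsHermitian := fun s =>
    dWaveSourceTorus_isHermitian L (isHermitian_hubbardTorusWith L 1 0 μ) s
  have hKU : ∀ s, (dWaveSourceTorus L U μ s).IsHermitian := fun s =>
    dWaveSourceTorus_isHermitian L (isHermitian_hubbardTorusWith L 1 U μ) s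
  have hX : ((U : ℂ) • doubleOcc L).IsHermitian := by
    have := (hKU h).sub (hK0 h)
    rwa [dWaveSourceTorus_eq_add_smul L U μ h, add_sub_cancel_left] at this
  have hXnorm : ‖(U : ℂ) • doubleOcc L‖ ≤ U * (L : ℝ) ^ 2 := by
    rw [norm_smul, Complex.norm_real, Real.norm_eq_abs, abs_of_nonneg hU]
    exact mul_le_mul_of_nonneg_left (norm_doubleOcc_le L) hU
  have e1 : (dWaveSourceTorus L U μ h).groundEnergy ≤
      (dWaveSourceTorus L 0 μ h).groundEnergy + U * (L : ℝ) ^ 2 := by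
    rw [dWaveSourceTorus_eq_add_smul L U μ h]
    exact (groundEnergy_add_le (hK0 h) hX).trans (by linarith)
  have e2 : (dWaveSourceTorus L 0 μ (2 * h)).groundEnergy ≤
      (dWaveSourceTorus L U μ (2 * h)).groundEnergy + U * (L : ℝ) ^ 2 := by
    have := groundEnergy_le_add (hK0 (2 * h)) hX
    rw [← dWaveSourceTorus_eq_add_smul L U μ (2 * h)] at this
    linarith
  have e3 := groundEnergy_dWaveSourceTorus_le (L := L) 0 μ h
  have e4 := groundEnergy_gain_le_dWaveSourceDensity (L := L) 0 μ (2 * h)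
  have e5 := dWaveSourceDensity_mul_le_groundEnergy_drop (L := L) U μ h (2 * h)
  have hL := cast_sq_pos_of_neZero L
  have hpos : (0 : ℝ) < 2 * h * (L : ℝ) ^ 2 := by positivity
  have key : h * (2 * (L : ℝ) ^ 2 * dWaveSourceDensity L U μ h) ≤
      2 * (2 * h) * (L : ℝ) ^ 2 * dWaveSourceDensity L 0 μ (2 * h) + 2 * U * (L : ℝ) ^ 2 := by
    have e5' : h * (2 * (L : ℝ) ^ 2 * dWaveSourceDensity L U μ h) ≤
        (dWaveSourceTorus L U μ h).groundEnergy - (dWaveSourceTorus L U μ (2 * h)).groundEnergy := by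
      have : (2 * h - h) = h := by ring
      rw [this] at e5
      exact e5
    linarith
  refine le_of_mul_le_mul_right ?_ hpos
  calc dWaveSourceDensity L U μ h * (2 * h * (L : ℝ) ^ 2)
      = h * (2 * (L : ℝ) ^ 2 * dWaveSourceDensity L U μ h) := by ring
    _ ≤ 2 * (2 * h) * (L : ℝ) ^ 2 * dWaveSourceDensity L 0 μ (2 * h) + 2 * U * (L : ℝ) ^ 2 := key
    _ = (2 * dWaveSourceDensity L 0 μ (2 * h) + U / h) * (2 * h * (L : ℝ) ^ 2) := by
        field_simp

/-- Choice of a small source: for `K, ε > 0` some `h ∈ (0, 1/2]` has `2K√(2h) ≤ ε`. -/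
theorem exists_small_source {K ε : ℝ} (hK : 0 < K) (hε : 0 < ε) :
    ∃ h ∈ Set.Ioc (0:ℝ) (1/2), 2 * K * Real.sqrt (2 * h) ≤ ε := by
  set a : ℝ := ε / (2 * K) with ha
  have ha0 : 0 < a := by positivity
  refine ⟨min (1/2) (a ^ 2 / 2), ⟨lt_min (by norm_num) (by positivity), min_le_left _ _⟩, ?_⟩
  have h2 : 2 * min (1/2) (a ^ 2 / 2) ≤ a ^ 2 := by
    have := min_le_right (1/2 : ℝ) (a ^ 2 / 2); linarith
  have h3 : Real.sqrt (2 * min (1/2) (a ^ 2 / 2)) ≤ a := by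
    calc Real.sqrt (2 * min (1/2) (a ^ 2 / 2)) ≤ Real.sqrt (a ^ 2) := Real.sqrt_le_sqrt h2
      _ = a := Real.sqrt_sq ha0.le
  calc 2 * K * Real.sqrt (2 * min (1/2) (a ^ 2 / 2)) ≤ 2 * K * a :=
        mul_le_mul_of_nonneg_left h3 (by positivity)
    _ = ε := by rw [ha]; field_simp

/-- **The weak-coupling ceiling on the order parameter.** For `[μ₁,μ₂] ⊂ (-4,0)` there is `K > 0` with
`dWaveOrderParameter U μ ≤ 2K√(2h) + U/h` for all `U ≥ 0`, `μ ∈ [μ₁,μ₂]`, `h ∈ (0,1/2]`; optimising,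
`m(U,μ) = O(U^{1/3})` — the order parameter of the weak-coupling window necessarily VANISHES as `U → 0⁺`,
uniformly on compacts of the hole-doped free band. -/
theorem orderParameter_le_weakCoupling (μ₁ μ₂ : ℝ) (h4 : -4 < μ₁) (h12 : μ₁ ≤ μ₂) (h0 : μ₂ < 0) :
    ∃ K : ℝ, 0 < K ∧ ∀ U : ℝ, 0 ≤ U → ∀ μ ∈ Set.Icc μ₁ μ₂, ∀ h ∈ Set.Ioc (0:ℝ) (1/2),
      dWaveOrderParameter U μ ≤ 2 * K * Real.sqrt (2 * h) + U / h := by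
  obtain ⟨K, hK, hfree⟩ := free_density_le_sqrt μ₁ μ₂ h4 h12 h0
  refine ⟨K, hK, fun U hU μ hμ h hh => ?_⟩
  have hh0 : 0 < h := hh.1
  have h2h : 2 * h ∈ Set.Ioc (0:ℝ) 1 := ⟨by linarith, by linarith [hh.2]⟩
  obtain ⟨L₀, hL₀⟩ := hfree (2 * h) h2h μ hμ
  refine (dWaveOrderParameter_le_liminf U μ hh0).trans ?_
  have hev : ∀ᶠ L : ℕ in atTop, dWaveSourceDensity (L + 1) U μ h ≤ 2 * K * Real.sqrt (2 * h) + U / h := by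
    refine eventually_atTop.2 ⟨L₀, fun L hL => ?_⟩
    have hfL := hL₀ (L + 1) (by omega)
    have := density_le_free (L := L + 1) hU μ hh0
    nlinarith
  refine liminf_le_of_frequently_le hev.frequently ?_
  exact isBoundedUnder_of_eventually_ge (a := 0)
    (Eventually.of_forall fun L => dWaveSourceDensity_nonneg U μ hh0.le)

/-- **The free torus has no `d`-wave Koma–Tasaki order** on the hole-doped band `μ ∈ (-4,0)`:
`dWaveOrderParameter 0 μ = 0` (the sourced response is `O(√h)`, in truth `∼ h log(1/h)`: sub-linear). -/
theorem dWaveOrderParameter_free_eq_zero (μ : ℝ) (hμ : μ ∈ Set.Ioo (-4:ℝ) 0) :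
    dWaveOrderParameter 0 μ = 0 := by
  obtain ⟨K, hK, hle⟩ := orderParameter_le_weakCoupling μ μ hμ.1 le_rfl hμ.2
  refine le_antisymm ?_ (dWaveOrderParameter_nonneg 0 μ)
  by_contra hpos
  push Not at hpos
  obtain ⟨h, hh, hsmall⟩ := exists_small_source hK (half_pos hpos)
  have := hle 0 le_rfl μ ⟨le_rfl, le_rfl⟩ h hh
  rw [zero_div, add_zero] at this
  linarith

/-- Hence `¬ HasDWaveOrder 0 μ` for `μ ∈ (-4,0)`: the coupling `U = 0` is orderless. -/
theorem not_hasDWaveOrder_free (μ : ℝ) (hμ : μ ∈ Set.Ioo (-4:ℝ) 0) : ¬ HasDWaveOrder 0 μ := by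
  rw [hasDWaveOrder_iff, dWaveOrderParameter_free_eq_zero μ hμ]
  exact lt_irrefl 0

/-- **Uniform vanishing at weak coupling**: for `[μ₁,μ₂] ⊂ (-4,0)` and every `ε > 0` there is `U₀ > 0`
with `dWaveOrderParameter U μ ≤ ε` for ALL `U ∈ [0,U₀)` and ALL `μ ∈ [μ₁,μ₂]`. -/
theorem orderParameter_small_of_weakCoupling (μ₁ μ₂ : ℝ) (h4 : -4 < μ₁) (h12 : μ₁ ≤ μ₂) (h0 : μ₂ < 0)
    {ε : ℝ} (hε : 0 < ε) :
    ∃ U₀ : ℝ, 0 < U₀ ∧ ∀ U ∈ Set.Ico (0:ℝ) U₀, ∀ μ ∈ Set.Icc μ₁ μ₂, dWaveOrderParameter U μ ≤ ε := by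
  obtain ⟨K, hK, hle⟩ := orderParameter_le_weakCoupling μ₁ μ₂ h4 h12 h0
  obtain ⟨h, hh, hsmall⟩ := exists_small_source hK (half_pos hε)
  have hh0 : 0 < h := hh.1
  refine ⟨ε * h / 2, by positivity, fun U hU μ hμ => ?_⟩
  have h1 := hle U hU.1 μ hμ h hh
  have h2 : U / h ≤ ε / 2 := by
    rw [div_le_iff₀ hh0]
    have := hU.2
    linarith
  linarith


end WeakCouplingCeiling

/-! ### §5a' LANDED (p73014, commit 49d11caca278): the content of this section is in the tree as
`Summits/HubbardSuperconductivity/HubbardSuperconductivity/Theorems/NodalReduction/Negative/WeakCouplingOrderCeiling.lean`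
(namespace `Summit.HubbardSuperconductivity.HubbardSuperconductivity.Theorems.NodalReduction.Negative`):
`groundEnergy_add_le`, `groundEnergy_le_add`, `dWaveSourceTorus_eq_add_smul`, `norm_doubleOcc_le`,
`density_le_free`, `free_gain_le`, `free_density_le_sqrt`, `orderParameter_le_weakCoupling`,
`dWaveOrderParameter_free_eq_zero`, `not_hasDWaveOrder_free`, `orderParameter_small_of_weakCoupling`,
`window_false_fromZero`, `window_false_uniformOrder` — ideators/planners/provers may IMPORT that module instead of
re-proving; the copies below keep this workfile self-contained. -/

/-! ### §5b Refuted natural strengthenings of the window -/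

/-- STRENGTHENING S0 (closed coupling interval): the window with `U = 0` ALLOWED, chemical potentials on a
compact of the hole-doped free band. -/
def WindowFromZeroOn (μ₁ μ₂ : ℝ) : Prop :=
  ∃ U₀ : ℝ, 0 < U₀ ∧ ∀ U ∈ Set.Ico (0:ℝ) U₀, ∃ μ ∈ Set.Icc μ₁ μ₂, HasDWaveOrder U μ

/-- **S0 is false**: at `U = 0` no `μ ∈ (-4,0)` carries `d`-wave order (`not_hasDWaveOrder_free`). The open
endpoint `0 < U` of the crux's window is load-bearing in the cheapest possible way. -/
theorem not_windowFromZeroOn {μ₁ μ₂ : ℝ} (h4 : -4 < μ₁) (h0 : μ₂ < 0) : ¬ WindowFromZeroOn μ₁ μ₂ := by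
  rintro ⟨U₀, hU₀, hw⟩
  obtain ⟨μ, hμ, hord⟩ := hw 0 ⟨le_rfl, hU₀⟩
  exact not_hasDWaveOrder_free μ ⟨lt_of_lt_of_le h4 hμ.1, lt_of_le_of_lt hμ.2 h0⟩ hord

/-- STRENGTHENING S1 (order uniform in the coupling): a floor `m₀ > 0` on the order parameter for ALL small
`U`, at chemical potentials confined to a compact of the hole-doped free band. -/
def WindowUniformOrderOn (μ₁ μ₂ : ℝ) : Prop :=
  ∃ m₀ : ℝ, 0 < m₀ ∧ ∃ U₀ : ℝ, 0 < U₀ ∧ ∀ U ∈ Set.Ioo (0:ℝ) U₀, ∃ μ ∈ Set.Icc μ₁ μ₂,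
    m₀ ≤ dWaveOrderParameter U μ

/-- **S1 is false** for every `[μ₁,μ₂] ⊂ (-4,0)`: the order parameter is `≤ ε` for all `U < U₀(ε)` uniformly
in `μ ∈ [μ₁,μ₂]` (`orderParameter_small_of_weakCoupling`). So the window, if true, is a window of
PARAMETRICALLY WEAK order: any proof must produce `m(U, μ_U) → 0` as `U → 0⁺` (consistent with the sibling
crux's floor `exp(-C/U²)`, which this ceiling does not touch), and no `U`-independent mechanism can give it. -/
theorem not_windowUniformOrderOn {μ₁ μ₂ : ℝ} (h4 : -4 < μ₁) (h12 : μ₁ ≤ μ₂) (h0 : μ₂ < 0) :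
    ¬ WindowUniformOrderOn μ₁ μ₂ := by
  rintro ⟨m₀, hm₀, U₀, hU₀, hw⟩
  obtain ⟨U₁, hU₁, hsmall⟩ := orderParameter_small_of_weakCoupling μ₁ μ₂ h4 h12 h0 (half_pos hm₀)
  have hm : 0 < min U₀ U₁ := lt_min hU₀ hU₁
  obtain ⟨μ, hμ, hfloor⟩ := hw (min U₀ U₁ / 2)
    ⟨half_pos hm, lt_of_lt_of_le (half_lt_self hm) (min_le_left _ _)⟩
  have hle := hsmall (min U₀ U₁ / 2)
    ⟨(half_pos hm).le, lt_of_lt_of_le (half_lt_self hm) (min_le_right _ _)⟩ μ hμ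
  linarith

/-- The same ceiling read on the window itself: along any window whose matched chemical potentials stay in a
compact `[μ₁,μ₂] ⊂ (-4,0)` (DOC: for `δ ∈ (0,1/2)` fixed and `U → 0⁺` the matched `μ_U` tends to the free
value `μ₀(δ) ∈ (μ₀(1/2), 0) ⊂ (-4,0)`; not formalised — it needs the interacting density), the order
parameter at the window's own `μ_U` is eventually below any `ε > 0`. -/
theorem window_order_le {μ₁ μ₂ : ℝ} (h4 : -4 < μ₁) (h12 : μ₁ ≤ μ₂) (h0 : μ₂ < 0) {ε : ℝ} (hε : 0 < ε) :
    ∃ U₀ : ℝ, 0 < U₀ ∧ ∀ U ∈ Set.Ioo (0:ℝ) U₀, ∀ δ μ : ℝ, μ ∈ Set.Icc μ₁ μ₂ →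
      DensityMatched U δ μ → HasDWaveOrder U μ → dWaveOrderParameter U μ ≤ ε := by
  obtain ⟨U₀, hU₀, hsmall⟩ := orderParameter_small_of_weakCoupling μ₁ μ₂ h4 h12 h0 hε
  exact ⟨U₀, hU₀, fun U hU _ μ hμ _ _ => hsmall U ⟨hU.1.le, hU.2⟩ μ hμ⟩

end Summit.HubbardSuperconductivity.HubbardSuperconductivity.Cruxes.NodalReduction.Disproof
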